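import Summits.BirchSwinnertonDyer.Rank1Residual.Supersingular.X7ToricPeriodUnit
import Summits.BirchSwinnertonDyer.BirchSwinnertonDyer.Theorems.Rank1ResidualIntModelReduction
import Literature.NumberTheory.DiophantineGeometry.EllArithGlueProofs
import Literature.NumberTheory.EllipticCurves.BSDRootNumberLocalTablesProofs
import Summits.BirchSwinnertonDyer.Rank1Residual.X11b.BDPRouteTamagawaSupport
import HarnessLib

/-!
# Route `SignedLowerHalves`, crux `KobayashiLowerHalfSemistable` (item stmt-BirchSwinnertonDyer-19000): a kernel
# OBSTRUCTION for the rank-0 AVATAR line — the (A3) avatar `X7.ToricPeriodUnitAt W p` forces `ρ̄_{E,p}` to be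
# RAMIFIED at every prime exactly dividing the conductor; it is VOID on the A6 cell `22678e1 @ 5`
# (cell `bsd-ssimc`, seat `bsd-ssimc-k3-c2` gen 4; a `--supports … --as helper` file, closes nothing)

PARTITION (cell bsd-ssimc): X6 ∧ r = 0 (A6) × the one cell at `p ≥ 5` (`22678e1 @ 5`) and the rank-0 avatar line
(`X6.kobayashiLowerDivisibility_of_toricPeriodUnitAt_of_analyticRank_eq_zero`,
`Supersingular/X7ToricPeriodUnitMainConjecture.lean`) — types-the-object-of (a NEGATIVE lemma on a LINE, not on the
crux); closes NONE; nothing booked. HONEST FRAMING: nothing here proves or refutes Kobayashi's conjecture for any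
curve; BSD is not proved by any of this; the item stays OPEN.

## What is proved (unconditional; no named fact is used)

The typed input `X7.ToricPeriodUnitAt W p` (`Supersingular/X7ToricPeriodUnit.lean`) packages definite level-raising
data `X7.ToricPeriodUnitData` relative to a factorisation `N_E = N⁺N⁻` (`GrossWaldspurgerCondition`: first conjunct
`N⁺ · N⁻ = N_E`) whose side conditions include `ramified : ∀ ℓ ∣ N⁻, p ∤ ord_ℓ Δ_min` (Kim 2024 §2.1 / Zhang ♥(1) at
`N⁻`) and `heart_one : ∀ ℓ ∥ N⁺, p ∤ ord_ℓ Δ_min` (Zhang's ♥(1) at `N⁺`). Elementary bookkeeping gives: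

* `not_dvd_factorization_minimalDiscriminantNorm_of_toricPeriodUnitData` / `…_of_toricPeriodUnitAt`: for EVERY prime
  `ℓ` with `ℓ ∣ N_E`, `ℓ² ∤ N_E`: `p ∤ ord_ℓ Δ_min` — i.e. `ρ̄_{E,p}` is ramified at every prime exactly dividing the
  conductor (no room is left by the choice of `(N⁺, N⁻)`: such an `ℓ` divides exactly one of them, to the first power);
* `…_of_toricPeriodUnitAt_of_mult`: the same at every prime of MULTIPLICATIVE reduction (`ℓ ∥ N_E` by Silverman ATAEC
  IV.10.2, tree `dvd_conductorNorm_iff_not_hasGoodReductionAtPrime` / `natGenerator_sq_dvd_conductorNorm_iff`), also in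
  the `padicValInt ℓ (minimalDiscriminantInt W)` currency of the cell's certificate records;
* `forall_not_dvd_of_semistable_of_toricPeriodUnitAt`: on a SEMISTABLE curve (class X6) the avatar needs `p ∤ ord_ℓ Δ_min`
  at EVERY bad prime `ℓ`; `not_toricPeriodUnitAt_of_mult_of_dvd`: one multiplicative prime `ℓ` with `p ∣ ord_ℓ Δ_min`
  makes `X7.ToricPeriodUnitAt W p` FALSE;
* `not_toricPeriodUnitAt_c22678e1_5`: for `22678e1 = [1,0,0,3140254662,−139987982322460]` (the only X6 ∧ r = 0 cell of
  the cell window at `p ≥ 5`; `N = 2·17·23·29`, `Δ_min = −2⁷⁵·17·23·29⁴`) the prime `2` is multiplicative with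
  `ord₂ Δ_min = 75 ≡ 0 (mod 5)`, so `¬ X7.ToricPeriodUnitAt W 5`: the rank-0 avatar road (seat `bsd-ssimc-lev` gen 3,
  p412249) has a false hypothesis on this pair AS TYPED (k3c2-MEMO-1 §3 recorded the observation; this file is its
  kernel form). Whether W. Zhang's printed ♥(1) needs ramification at a split prime `ℓ ≢ ±1 (mod p)` is a reading
  question for the avatar's owner (a CR-type weakening of `heart_one` would re-admit `2 ∈ N⁺` here); the lemma is
  about the predicate as it stands in the tree.
* (appended, same seat) `not_toricPeriodUnitAt_of_dvd_tamagawaProduct` / `not_dvd_tamagawaProduct_of_toricPeriodUnitAt`: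
  for EVERY `E/ℚ` and `p ≥ 5`, `p ∣ ∏_ℓ c_ℓ(E) ⇒ ¬ X7.ToricPeriodUnitAt W p` — a prime `p ≥ 5` of `∏c_ℓ` sits in
  `c_ℓ = ord_ℓ Δ_min` at a SPLIT multiplicative `ℓ` (tree `X11b.dvd_tamagawaProduct_iff_exists_split`), where
  `ρ̄_{E,p}` is then unramified: the avatar road and the Tamagawa-defect locus are disjoint (it can only serve
  Ш-defect pairs).
* (appended, same seat) `not_toricPeriodUnitAt_c492414f1_5`, `…_c130798a1_7`, `…_c399190l1_7`, `…_c145146q1_5`: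
  the avatar is void on four more of the eight X6 ∧ r = 0 (~) cells of the cell window at `p ≥ 5` (unramified
  multiplicative prime `2`, `2`, `19`, `3` resp.: `ord Δ_min = 20, 14, 21, 10`); on the remaining three
  (`236810a1 @ 13`, `297402n1 @ 11`, `421511a1 @ 13`: every exponent of `Δ_min` prime to `p`) this obstruction
  does not fire — nothing is claimed about them.

References: [Kim2024] §2.1, Thm. 5.23 (shape of the data); [WZhang2014] Hypothesis ♥ (pp. 202–203);
[CaiShuTian2014] Thm. 1.2 (i)–(ii); [Silverman1994] IV.10.2; [SilvermanAEC2009] VII.5 Prop. 5.1, VIII.8;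
[Cremona2006] Table 1 (label 22678e1); cell records k3c2-MEMO-1 §3, lev MEMO-3 addendum B (I3).
-/

set_option autoImplicit false
set_option linter.dupNamespace false

noncomputable section

namespace Summit.BirchSwinnertonDyer.BirchSwinnertonDyer.Theorems

open scoped Classical

open WeierstrassCurve NumberField IsDedekindDomain Rat.HeightOneSpectrum Literature.NumberTheory.EllipticCurves
  Literature.NumberTheory.EllipticCurves.Rank1Residual
  Literature.NumberTheory.EllipticCurves.CaiShuTian2014
  Literature.NumberTheory.Automorphic
  Summit.BirchSwinnertonDyer.Rank1Residual.Supersingular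
  Summit.BirchSwinnertonDyer.BirchSwinnertonDyer.Rank1Residual.IntModel

/-! ### The avatar forces `ρ̄_{E,p}` ramified at every prime exactly dividing `N_E` -/

/-- **The (A3) data force `p ∤ ord_ℓ Δ_min` at every `ℓ ∥ N_E`.** For data `X7.ToricPeriodUnitData W p K n S₁ Sₙ …`
relative to `(N⁺, N⁻)`: `N⁺N⁻ = N_E` (`grossWaldspurger`), so a prime `ℓ` with `ℓ ∣ N_E`, `ℓ² ∤ N_E` divides `N⁻`
(then field `ramified`) or divides `N⁺` exactly once (then field `heart_one`, Zhang's ♥(1)). Pure bookkeeping on the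
structure; unconditional. [cite: WZhang2014, Hypothesis ♥ (1) (pp. 202–203)] [cite: Kim2024, §2.1 (a)–(e)] -/
theorem not_dvd_factorization_minimalDiscriminantNorm_of_toricPeriodUnitData
    {W : WeierstrassCurve ℚ} {p : ℕ} {K : Type} [Field K] [NumberField K] {Nplus Nminus : ℕ} {n : ℕ}
    {S₁ : Brandt.XiSetup Nplus Nminus} [Fintype (Brandt.ClassSet S₁.O)]
    {Sₙ : Brandt.XiSetup Nplus (Nminus * n)} [Fintype (Brandt.ClassSet Sₙ.O)]
    {ψ₁ : K →ₐ[ℚ] S₁.D} {ψₙ : K →ₐ[ℚ] Sₙ.D} {φ₁ f₁ : Brandt.ClassSet S₁.O → ℤ} {c : ℤ}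
    {fₙ : Brandt.ClassSet Sₙ.O → ZMod p}
    (h : X7.ToricPeriodUnitData W p K n S₁ Sₙ ψ₁ ψₙ φ₁ f₁ c fₙ)
    {ℓ : ℕ} (hℓ : ℓ.Prime) (hdvd : ℓ ∣ W.conductorNorm ℤ) (hsq : ¬ ℓ ^ 2 ∣ W.conductorNorm ℤ) :
    ¬ p ∣ (W.minimalDiscriminantNorm ℤ).factorization ℓ := by
  have hN : Nplus * Nminus = W.conductorNorm ℤ := h.grossWaldspurger.1
  rw [← hN] at hdvd hsq
  have hplus0 : Nplus ≠ 0 := by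
    rintro rfl
    exact hsq (by rw [zero_mul]; exact dvd_zero _)
  have hminus0 : Nminus ≠ 0 := by
    rintro rfl
    exact hsq (by rw [mul_zero]; exact dvd_zero _)
  rcases (Nat.Prime.dvd_mul hℓ).mp hdvd with hP | hM
  · -- `ℓ ∣ N⁺`, hence `ℓ ∥ N⁺` (else `ℓ² ∣ N⁺N⁻`): Zhang's ♥(1)
    have hmem : ℓ ∈ Nplus.primeFactors := Nat.mem_primeFactors.mpr ⟨hℓ, hP, hplus0⟩
    have hsqP : ¬ ℓ ^ 2 ∣ Nplus := fun h2 ↦ hsq (h2.mul_right Nminus)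
    exact h.heart_one ℓ hmem hsqP
  · -- `ℓ ∣ N⁻`: field `ramified`
    have hmem : ℓ ∈ Nminus.primeFactors := Nat.mem_primeFactors.mpr ⟨hℓ, hM, hminus0⟩
    exact h.ramified ℓ hmem

/-- **The typed input `X7.ToricPeriodUnitAt W p` forces `p ∤ ord_ℓ Δ_min` at every prime `ℓ` exactly dividing the
conductor** (`ρ̄_{E,p}` ramified at every `ℓ ∥ N_E`): existential closure of
`not_dvd_factorization_minimalDiscriminantNorm_of_toricPeriodUnitData`. Unconditional.
[cite: WZhang2014, Hypothesis ♥ (1) (pp. 202–203)] [cite: Kim2024, §2.1 (a)–(e)] -/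
theorem not_dvd_factorization_minimalDiscriminantNorm_of_toricPeriodUnitAt
    {W : WeierstrassCurve ℚ} {p : ℕ} (h : X7.ToricPeriodUnitAt W p)
    {ℓ : ℕ} (hℓ : ℓ.Prime) (hdvd : ℓ ∣ W.conductorNorm ℤ) (hsq : ¬ ℓ ^ 2 ∣ W.conductorNorm ℤ) :
    ¬ p ∣ (W.minimalDiscriminantNorm ℤ).factorization ℓ := by
  obtain ⟨K, _, _, Nplus, Nminus, n, S₁, _, Sₙ, _, ψ₁, ψₙ, φ₁, f₁, c, fₙ, hD⟩ := h
  exact not_dvd_factorization_minimalDiscriminantNorm_of_toricPeriodUnitData hD hℓ hdvd hsq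

/-! ### At primes of multiplicative reduction (`ℓ ∥ N_E`) -/

/-- `ℓ² ∤ N_E` at a prime `ℓ` of multiplicative reduction (`f_ℓ = 1`; Silverman ATAEC IV.10.2: `ℓ² ∣ N_E` iff additive
at the place over `ℓ`, tree `natGenerator_sq_dvd_conductorNorm_iff`). [cite: Silverman1994, IV.10.2(b),(c)] -/
theorem not_sq_dvd_conductorNorm_of_hasMultiplicativeReductionAtPrime (W : WeierstrassCurve ℚ) [W.IsElliptic]
    (ℓ : ℕ) [Fact ℓ.Prime] (hmult : W.HasMultiplicativeReductionAtPrime ℓ) :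
    ¬ ℓ ^ 2 ∣ W.conductorNorm ℤ := by
  have hℓ : ℓ.Prime := Fact.out
  set v : HeightOneSpectrum ℤ := (primesEquiv (R := ℤ)).symm ⟨ℓ, hℓ⟩ with hv
  have hgen : natGenerator v = ℓ :=
    congrArg Subtype.val ((primesEquiv (R := ℤ)).apply_symm_apply ⟨ℓ, hℓ⟩)
  have hmv : W.HasMultiplicativeReductionAt v :=
    (W.hasMultiplicativeReductionAtPrime_iff_hasMultiplicativeReductionAt_holds ⟨ℓ, hℓ⟩).mp hmult
  intro h2
  rw [← hgen] at h2
  exact hmv.not_hasAdditiveReductionAt ((natGenerator_sq_dvd_conductorNorm_iff v W).mp h2)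

/-- **At a prime `ℓ` of MULTIPLICATIVE reduction the avatar needs `p ∤ ord_ℓ Δ_min`** (`ℓ ∣ N_E` by bad reduction,
tree `dvd_conductorNorm_iff_not_hasGoodReductionAtPrime`; `ℓ² ∤ N_E` by `not_sq_dvd_conductorNorm_of_hasMultiplicativeReductionAtPrime`).
Unconditional. [cite: WZhang2014, Hypothesis ♥ (1) (pp. 202–203)] [cite: Silverman1994, IV.10.2] -/
theorem not_dvd_factorization_minimalDiscriminantNorm_of_toricPeriodUnitAt_of_mult
    {W : WeierstrassCurve ℚ} [W.IsElliptic] {p : ℕ} (h : X7.ToricPeriodUnitAt W p)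
    (ℓ : ℕ) [Fact ℓ.Prime] (hmult : W.HasMultiplicativeReductionAtPrime ℓ) :
    ¬ p ∣ (W.minimalDiscriminantNorm ℤ).factorization ℓ := by
  have hbad : ¬ W.HasGoodReductionAtPrime ℓ :=
    WeierstrassCurve.HasMultiplicativeReduction.not_hasGoodReduction (R := ℤ_[ℓ]) hmult
  exact not_dvd_factorization_minimalDiscriminantNorm_of_toricPeriodUnitAt h Fact.out
    ((W.dvd_conductorNorm_iff_not_hasGoodReductionAtPrime ℓ).mpr hbad)
    (not_sq_dvd_conductorNorm_of_hasMultiplicativeReductionAtPrime W ℓ hmult)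

/-- `ord_ℓ` of the minimal discriminant: the `ℓ`-exponent of `N(𝔇_min) = |Δ_min|` is `padicValInt ℓ Δ_min` for a
globally minimal `W` (tree `minimalDiscriminantNorm_int_eq_natAbs_minimalDiscriminantInt_holds`, Silverman AEC VIII.8).
[cite: SilvermanAEC2009, VIII.8 (minimal discriminant) and Cor. 8.3] -/
theorem factorization_minimalDiscriminantNorm_eq_padicValInt (W : WeierstrassCurve ℚ) [W.IsElliptic]
    [W.IsGloballyMinimal] (ℓ : ℕ) [Fact ℓ.Prime] :
    (W.minimalDiscriminantNorm ℤ).factorization ℓ = padicValInt ℓ (minimalDiscriminantInt W) := by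
  rw [minimalDiscriminantNorm_int_eq_natAbs_minimalDiscriminantInt_holds W, Nat.factorization_def _ Fact.out]
  rfl

/-- **The avatar in the cell's certificate currency**: at a multiplicative prime `ℓ` of a globally minimal `W`,
`X7.ToricPeriodUnitAt W p` forces `p ∤ padicValInt ℓ (minimalDiscriminantInt W)` (= `p ∤ ord_ℓ Δ(E₀)` for the
integer model `E₀`, `IntModel.minimalDiscriminantInt_eq`). Unconditional.
[cite: WZhang2014, Hypothesis ♥ (1) (pp. 202–203)] [cite: SilvermanAEC2009, VIII.8] -/
theorem not_dvd_padicValInt_minimalDiscriminantInt_of_toricPeriodUnitAt_of_mult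
    {W : WeierstrassCurve ℚ} [W.IsElliptic] [W.IsGloballyMinimal] {p : ℕ} (h : X7.ToricPeriodUnitAt W p)
    (ℓ : ℕ) [Fact ℓ.Prime] (hmult : W.HasMultiplicativeReductionAtPrime ℓ) :
    ¬ p ∣ padicValInt ℓ (minimalDiscriminantInt W) := by
  rw [← factorization_minimalDiscriminantNorm_eq_padicValInt W ℓ]
  exact not_dvd_factorization_minimalDiscriminantNorm_of_toricPeriodUnitAt_of_mult h ℓ hmult

/-- **One multiplicative prime `ℓ` with `p ∣ ord_ℓ Δ_min` (i.e. `ρ̄_{E,p}` unramified at `ℓ`) kills the avatar**: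
`¬ X7.ToricPeriodUnitAt W p`. Unconditional; a typed obstruction, not a statement about Kobayashi's conjecture.
[cite: WZhang2014, Hypothesis ♥ (1) (pp. 202–203)] [cite: Kim2024, §2.1 (a)–(e)] -/
theorem not_toricPeriodUnitAt_of_mult_of_dvd {W : WeierstrassCurve ℚ} [W.IsElliptic] [W.IsGloballyMinimal]
    {p : ℕ} (ℓ : ℕ) [Fact ℓ.Prime] (hmult : W.HasMultiplicativeReductionAtPrime ℓ)
    (hunr : p ∣ padicValInt ℓ (minimalDiscriminantInt W)) : ¬ X7.ToricPeriodUnitAt W p :=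
  fun h ↦ not_dvd_padicValInt_minimalDiscriminantInt_of_toricPeriodUnitAt_of_mult h ℓ hmult hunr

/-! ### On semistable curves (class X6): ramified at EVERY bad prime -/

/-- **On a SEMISTABLE curve the avatar needs `ρ̄_{E,p}` ramified at EVERY bad prime**: for `Semistable W`
(`Rank1Residual.Semistable`: good or multiplicative everywhere) and `X7.ToricPeriodUnitAt W p`, every prime `ℓ` of bad
reduction has `p ∤ ord_ℓ Δ_min`. Unconditional. [cite: WZhang2014, Hypothesis ♥ (1) (pp. 202–203)]
[cite: Silverman1994, IV.10.2] -/
theorem forall_not_dvd_of_semistable_of_toricPeriodUnitAt {W : WeierstrassCurve ℚ} [W.IsElliptic]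
    [W.IsGloballyMinimal] {p : ℕ} (hss : Semistable W) (h : X7.ToricPeriodUnitAt W p)
    (ℓ : ℕ) [hℓ : Fact ℓ.Prime] (hbad : ¬ W.HasGoodReductionAtPrime ℓ) :
    ¬ p ∣ padicValInt ℓ (minimalDiscriminantInt W) := by
  rcases hss ℓ hℓ.out with hgood | hmult
  · exact absurd hgood hbad
  · exact not_dvd_padicValInt_minimalDiscriminantInt_of_toricPeriodUnitAt_of_mult h ℓ hmult

/-! ### The A6 cell `22678e1 @ 5`: the avatar is VOID as typed -/

/-- **`¬ X7.ToricPeriodUnitAt W 5` for `W = 22678e1`** (Cremona's minimal model `[1,0,0,3140254662,−139987982322460]`,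
`N = 2·17·23·29`, `Δ_min = −2⁷⁵·17·23·29⁴`): `2` is a prime of multiplicative reduction (`2 ∣ Δ`, `2 ∤ c₄`, Silverman
AEC VII.5.1(b), kernel) with `ord₂ Δ_min = 75` (kernel: `2⁷⁵ ∣ Δ`, `2⁷⁶ ∤ Δ`), and `5 ∣ 75`: `ρ̄_{E,5}` is unramified at
`2 ∥ N`, so `2` can sit neither in `N⁻` (`ramified`) nor in `N⁺` (`heart_one`) — no admissible factorisation exists and
the rank-0 avatar road `X6.kobayashiLowerDivisibility_of_toricPeriodUnitAt_of_analyticRank_eq_zero` (p412249) has a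
false hypothesis `X7.ToricPeriodUnitAt W 5` on this pair. This is the only X6 ∧ r = 0 cell of the cell window at
`p ≥ 5`; its `KobayashiLowerDivisibility W 5 ε` stays typed modulo the scoped PRE binder
(`kobayashiLowerDivisibility_c22678e1_5_of_thm13_scoped_OPEN`). Unconditional; per pair; closes nothing.
[cite: Cremona2006, Table 1 (Cremona label 22678e1)] [cite: SilvermanAEC2009, VII.5 Prop. 5.1(b)]
[cite: WZhang2014, Hypothesis ♥ (1) (pp. 202–203)] -/
theorem not_toricPeriodUnitAt_c22678e1_5 {W : WeierstrassCurve ℚ} [W.IsElliptic] [W.IsGloballyMinimal]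
    (hWeq : W = ⟨1, 0, 0, 3140254662, -139987982322460⟩) : ¬ X7.ToricPeriodUnitAt W 5 := by
  haveI : Fact (Nat.Prime 2) := ⟨Nat.prime_two⟩
  have hIW : integralModelInt W = ⟨1, 0, 0, 3140254662, -139987982322460⟩ :=
    integralModelInt_eq_of_map_eq _ (by rw [hWeq]; ext <;> simp [WeierstrassCurve.map])
  -- `2` is multiplicative: `2 ∣ Δ(E₀)`, `2 ∤ c₄(E₀)`
  have hmult : W.HasMultiplicativeReductionAtPrime 2 :=
    hasMultiplicativeReductionAtPrime_of_intModel hIW 2 (by decide +kernel) (by decide +kernel)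
  -- `ord₂ Δ_min = 75`
  have hord : padicValInt 2 (minimalDiscriminantInt W) = 75 := by
    rw [minimalDiscriminantInt_eq hIW]
    exact padicValInt_eq_of_dvd_of_not_dvd 2 (e := 75) (by decide +kernel) (by decide +kernel)
  exact not_toricPeriodUnitAt_of_mult_of_dvd 2 hmult (by rw [hord]; decide)

/-! ### The avatar never reaches a TAMAGAWA-DEFECT pair (`p ≥ 5`, all curves) -/

/-- **The (A3) avatar road and the Tamagawa-defect locus are DISJOINT (`p ≥ 5`, every `E/ℚ`).** If
`p ∣ ∏_ℓ c_ℓ(E)` then `¬ X7.ToricPeriodUnitAt W p`. Indeed for `p ≥ 5` a prime `p ∣ ∏c_ℓ` divides some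
`c_ℓ`, and `c_ℓ ≤ 4 < p` unless `ℓ` is SPLIT multiplicative with `c_ℓ = ord_ℓ Δ_min` (Kodaira–Néron / Tate; tree
`X11b.dvd_tamagawaProduct_iff_exists_split`); so `p ∣ ord_ℓ Δ_min` at a multiplicative `ℓ ∥ N_E` — `ρ̄_{E,p}` is
unramified there — and `not_toricPeriodUnitAt_of_mult_of_dvd` applies. Reading for the cell: the rank-0 avatar road
(`X6.`/`X7.kobayashiLowerDivisibility_of_toricPeriodUnitAt_of_analyticRank_eq_zero`, p412249) can only ever serve
pairs with `p ∤ ∏c_ℓ` (the Ш-defect cells), never a Tamagawa-defect cell — on X6 ∧ r = 0 at `p ≥ 5` this is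
`22678e1 @ 5` (`c₂ = 75`) and, by the same token, every X6~/D-row pair whose open `p`-part comes from `p ∣ c_ℓ`.
Unconditional; a typed obstruction on a LINE, not a statement about Kobayashi's conjecture.
[cite: SilvermanATAEC1994, Cor. IV.9.2(d) with (b) (PDF p. 340)] [cite: WZhang2014, Hypothesis ♥ (1) (pp. 202–203)] -/
theorem not_toricPeriodUnitAt_of_dvd_tamagawaProduct {W : WeierstrassCurve ℚ} [W.IsElliptic]
    [W.IsGloballyMinimal] {p : ℕ} (hp : p.Prime) (hp5 : 5 ≤ p) (ht : p ∣ W.tamagawaProduct) :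
    ¬ X7.ToricPeriodUnitAt W p := by
  obtain ⟨ℓ, _, hs, hd⟩ :=
    (Summit.BirchSwinnertonDyer.Rank1Residual.X11b.dvd_tamagawaProduct_iff_exists_split W hp hp5).mp ht
  exact not_toricPeriodUnitAt_of_mult_of_dvd ℓ hs.hasMultiplicativeReductionAtPrime hd

/-- **Contrapositive, as a side condition the avatar silently carries**: `X7.ToricPeriodUnitAt W p` with `p ≥ 5`
forces `p ∤ ∏_ℓ c_ℓ(E)` (no displayed Tamagawa hypothesis on `E` is needed by the avatar's consumers — it is implied).
Unconditional. [cite: SilvermanATAEC1994, Cor. IV.9.2(d) with (b) (PDF p. 340)] [cite: Kim2024, §2.1 (a)–(e)] -/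
theorem not_dvd_tamagawaProduct_of_toricPeriodUnitAt {W : WeierstrassCurve ℚ} [W.IsElliptic]
    [W.IsGloballyMinimal] {p : ℕ} (hp : p.Prime) (hp5 : 5 ≤ p) (h : X7.ToricPeriodUnitAt W p) :
    ¬ p ∣ W.tamagawaProduct :=
  fun ht ↦ not_toricPeriodUnitAt_of_dvd_tamagawaProduct hp hp5 ht h

/-! ### The other X6 ∧ r = 0 (~) cells of the window at `p ≥ 5`: the avatar is void on four more -/

/-- **`¬ X7.ToricPeriodUnitAt W 5` for `W = 492414f1`** (Cremona's minimal model `[1, 1, 1, -174686782448, -28102134435119791]`, `N = 2·3·13·59·107`,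
`Δ_min = −2²⁰·3²⁸·13·59·107²`): the prime `2` is multiplicative (`2 ∣ Δ`, `2 ∤ c₄`, kernel) with `ord Δ_min = 20 ≡ 0 (mod 5)`,
so `ρ̄_{E,5}` is unramified at `2 ∥ N` and the (A3) avatar is void on this pair as typed
(`not_toricPeriodUnitAt_of_mult_of_dvd`). X6~ cell of the cell window (k3c2-MEMO-1-addA §A.2 row); unconditional;
per pair; closes nothing. [cite: Cremona2006, Table 1 (Cremona label 492414f1)] [cite: SilvermanAEC2009, VII.5 Prop. 5.1(b)]
[cite: WZhang2014, Hypothesis ♥ (1) (pp. 202–203)] -/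
theorem not_toricPeriodUnitAt_c492414f1_5 {W : WeierstrassCurve ℚ} [W.IsElliptic] [W.IsGloballyMinimal]
    (hWeq : W = ⟨1, 1, 1, -174686782448, -28102134435119791⟩) : ¬ X7.ToricPeriodUnitAt W 5 := by
  haveI : Fact (Nat.Prime 2) := ⟨by norm_num⟩
  have hIW : integralModelInt W = ⟨1, 1, 1, -174686782448, -28102134435119791⟩ :=
    integralModelInt_eq_of_map_eq _ (by rw [hWeq]; ext <;> simp [WeierstrassCurve.map])
  have hmult : W.HasMultiplicativeReductionAtPrime 2 :=
    hasMultiplicativeReductionAtPrime_of_intModel hIW 2 (by decide +kernel) (by decide +kernel)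
  have hord : padicValInt 2 (minimalDiscriminantInt W) = 20 := by
    rw [minimalDiscriminantInt_eq hIW]
    exact padicValInt_eq_of_dvd_of_not_dvd 2 (e := 20) (by decide +kernel) (by decide +kernel)
  exact not_toricPeriodUnitAt_of_mult_of_dvd 2 hmult (by rw [hord]; decide)

/-- **`¬ X7.ToricPeriodUnitAt W 7` for `W = 130798a1`** (Cremona's minimal model `[1, 1, 1, -1514781218, -22692641927633]`, `N = 2·17·3847`,
`Δ_min = 2¹⁴·17³·3847²`): the prime `2` is multiplicative (`2 ∣ Δ`, `2 ∤ c₄`, kernel) with `ord Δ_min = 14 ≡ 0 (mod 7)`,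
so `ρ̄_{E,7}` is unramified at `2 ∥ N` and the (A3) avatar is void on this pair as typed
(`not_toricPeriodUnitAt_of_mult_of_dvd`). X6~ cell of the cell window (k3c2-MEMO-1-addA §A.2 row); unconditional;
per pair; closes nothing. [cite: Cremona2006, Table 1 (Cremona label 130798a1)] [cite: SilvermanAEC2009, VII.5 Prop. 5.1(b)]
[cite: WZhang2014, Hypothesis ♥ (1) (pp. 202–203)] -/
theorem not_toricPeriodUnitAt_c130798a1_7 {W : WeierstrassCurve ℚ} [W.IsElliptic] [W.IsGloballyMinimal]
    (hWeq : W = ⟨1, 1, 1, -1514781218, -22692641927633⟩) : ¬ X7.ToricPeriodUnitAt W 7 := by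
  haveI : Fact (Nat.Prime 2) := ⟨by norm_num⟩
  have hIW : integralModelInt W = ⟨1, 1, 1, -1514781218, -22692641927633⟩ :=
    integralModelInt_eq_of_map_eq _ (by rw [hWeq]; ext <;> simp [WeierstrassCurve.map])
  have hmult : W.HasMultiplicativeReductionAtPrime 2 :=
    hasMultiplicativeReductionAtPrime_of_intModel hIW 2 (by decide +kernel) (by decide +kernel)
  have hord : padicValInt 2 (minimalDiscriminantInt W) = 14 := by
    rw [minimalDiscriminantInt_eq hIW]
    exact padicValInt_eq_of_dvd_of_not_dvd 2 (e := 14) (by decide +kernel) (by decide +kernel)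
  exact not_toricPeriodUnitAt_of_mult_of_dvd 2 hmult (by rw [hord]; decide)

/-- **`¬ X7.ToricPeriodUnitAt W 7` for `W = 399190l1`** (Cremona's minimal model `[1, -1, 1, -8615202972, -2594053676135591]`, `N = 2·5·11·19·191`,
`Δ_min = −2·5·11·19²¹·191²`): the prime `19` is multiplicative (`19 ∣ Δ`, `19 ∤ c₄`, kernel) with `ord Δ_min = 21 ≡ 0 (mod 7)`,
so `ρ̄_{E,7}` is unramified at `19 ∥ N` and the (A3) avatar is void on this pair as typed
(`not_toricPeriodUnitAt_of_mult_of_dvd`). X6~ cell of the cell window (k3c2-MEMO-1-addA §A.2 row); unconditional;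
per pair; closes nothing. [cite: Cremona2006, Table 1 (Cremona label 399190l1)] [cite: SilvermanAEC2009, VII.5 Prop. 5.1(b)]
[cite: WZhang2014, Hypothesis ♥ (1) (pp. 202–203)] -/
theorem not_toricPeriodUnitAt_c399190l1_7 {W : WeierstrassCurve ℚ} [W.IsElliptic] [W.IsGloballyMinimal]
    (hWeq : W = ⟨1, -1, 1, -8615202972, -2594053676135591⟩) : ¬ X7.ToricPeriodUnitAt W 7 := by
  haveI : Fact (Nat.Prime 19) := ⟨by norm_num⟩
  have hIW : integralModelInt W = ⟨1, -1, 1, -8615202972, -2594053676135591⟩ :=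
    integralModelInt_eq_of_map_eq _ (by rw [hWeq]; ext <;> simp [WeierstrassCurve.map])
  have hmult : W.HasMultiplicativeReductionAtPrime 19 :=
    hasMultiplicativeReductionAtPrime_of_intModel hIW 19 (by decide +kernel) (by decide +kernel)
  have hord : padicValInt 19 (minimalDiscriminantInt W) = 21 := by
    rw [minimalDiscriminantInt_eq hIW]
    exact padicValInt_eq_of_dvd_of_not_dvd 19 (e := 21) (by decide +kernel) (by decide +kernel)
  exact not_toricPeriodUnitAt_of_mult_of_dvd 19 hmult (by rw [hord]; decide)

/-- **`¬ X7.ToricPeriodUnitAt W 5` for `W = 145146q1`** (Cremona's minimal model `[1, 0, 1, -3229945761, -70654953055340]`, `N = 2·3·17·1423`,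
`Δ_min = 2²⁷·3¹⁰·17·1423`): the prime `3` is multiplicative (`3 ∣ Δ`, `3 ∤ c₄`, kernel) with `ord Δ_min = 10 ≡ 0 (mod 5)`,
so `ρ̄_{E,5}` is unramified at `3 ∥ N` and the (A3) avatar is void on this pair as typed
(`not_toricPeriodUnitAt_of_mult_of_dvd`). X6~ cell of the cell window (k3c2-MEMO-1-addA §A.2 row); unconditional;
per pair; closes nothing. [cite: Cremona2006, Table 1 (Cremona label 145146q1)] [cite: SilvermanAEC2009, VII.5 Prop. 5.1(b)]
[cite: WZhang2014, Hypothesis ♥ (1) (pp. 202–203)] -/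
theorem not_toricPeriodUnitAt_c145146q1_5 {W : WeierstrassCurve ℚ} [W.IsElliptic] [W.IsGloballyMinimal]
    (hWeq : W = ⟨1, 0, 1, -3229945761, -70654953055340⟩) : ¬ X7.ToricPeriodUnitAt W 5 := by
  haveI : Fact (Nat.Prime 3) := ⟨by norm_num⟩
  have hIW : integralModelInt W = ⟨1, 0, 1, -3229945761, -70654953055340⟩ :=
    integralModelInt_eq_of_map_eq _ (by rw [hWeq]; ext <;> simp [WeierstrassCurve.map])
  have hmult : W.HasMultiplicativeReductionAtPrime 3 :=
    hasMultiplicativeReductionAtPrime_of_intModel hIW 3 (by decide +kernel) (by decide +kernel)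
  have hord : padicValInt 3 (minimalDiscriminantInt W) = 10 := by
    rw [minimalDiscriminantInt_eq hIW]
    exact padicValInt_eq_of_dvd_of_not_dvd 3 (e := 10) (by decide +kernel) (by decide +kernel)
  exact not_toricPeriodUnitAt_of_mult_of_dvd 3 hmult (by rw [hord]; decide)

end Summit.BirchSwinnertonDyer.BirchSwinnertonDyer.Theorems

end
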